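import Summits.QuantumFields.YangMills.Theorems.UnitScaleTiltProp7SectET3RealityPInvOneT3
import Summits.QuantumFields.YangMills.Theorems.UnitScaleTiltProp7SectET3DeltaOneT3PInvGlue
import Summits.QuantumFields.YangMills.Theorems.UnitScaleTiltProp7SectET3DeltaOneT3JTermRowsRegPr
import HarnessLib

/-!
# Route `UnitScaleTilt`, crux K1 child «MinimiserStabilityRegPr» (stmt-QuantumFields-19200), stub `stub_existenceMinimalOrbit` (EX), route (α) — (C2′) PINV CASCADE, FILE P3 PART 2b
# «REALITY-PINV AT Δ₁ OF RECORD»: THE THREE ROWS OF THE J-TERM AT THE PINV LETTER `T_Jᴾ` AND THE KNIT'S `h𝒢R` ∕ `hH₁R` CLAUSES AT `DeltaOnePJ := DeltaOneP TJSlotP`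
# — UNCONDITIONAL AT `U₀ ∈ 𝔘_k(ε₀)` (part 2a = ✓`…RealityPInvOneT3`: `Δ₁ᴾ` at a generic J-term slot)

Cell `ym3-torus`, width seat `ym3-torus-px3` (gen 2; EX namer ★w2-19200 g6 cascade P0–P6 (P3) + SLOT WORD 2026-08-28T20:48:46Z «`𝒢f∕H₁f` live at print's Δ₁ — `DeltaOnePJ`» + 21:03:43Z
«P3 PRECISELY … for `Δx := DeltaPiSlotP U₀` AND `Δx := DeltaOnePJ U₀`»).  Part 1 = ✓`Prop7SectET3RealityPInv` (the `Δ_πᴾ` half).  THEOREMS ONLY (0 `def`, 0 `sorry`);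
`--supports stmt-QuantumFields-19200 --as helper`; count-neutral.  YM₃ on T³ is a ladder rung (R3), NOT the Clay problem; nothing here is a claim about the stub, the crux, d = 4 or
the mass gap.

THE PRINT.  [Balaban1985BackgroundPropagators] (3.127)–(3.129) p. 421 (`Δ₁ = Pᵀ(Δ + T_J)P`, the J-term `−2⟨HC⁽²⁾(A), J⟩`, `G₁`, `H₁`), (3.119) p. 419, (3.126) p. 420, p. 393 «The operators …
are real»; [Balaban1985Variational] (51) p. 286, (103) p. 293, (110)–(111) p. 294.  HONESTY CLAUSE (RULING g28-№4 AMENDMENT): `G′ᴾ` is the pinv of the TREE's `Δ′_a` (finite-rank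
off print's); reality is insensitive to that bookkeeping.

WHAT THIS FILE PROVES (sorry-free, no definition; the texts of ✓`Prop7SectET3DeltaOneT3SlotRealityRows` + ✓`…DeltaOneT3JTermRows`∕`…RowsRegPr` at the pinv letters `Pᴾ`, `H46P`,
`T_Jᴾ`, with `ha : 0 ≤ a` replacing the vacuous class; [folklore] bookkeeping except where cited).
* (glue for the J-term letters — `tjFormP_apply`, `tjSesqP_apply`, `inner_TJP_left`, `TJSlotP_apply`, `DeltaOnePJ_def` — is ★px16 g2's ✓`…SectET3DeltaOneT3PInvGlue`, imported.)
* §4 THE J-TERM AT THE PINV LETTER: `H46P_star_comm`, `tjFormP_symm`, `tjFormP_apply_smul_one`, `tjFormP_smul_one_apply`, ★`tjFormP_star`, `tjSesqP_conj_symm`,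
  ★`TJP_toL2_star_of_rows`, ★`trace_TJP_toL2_eq_zero_of_rows`, ★★`TJP_rows_of_regPr (hAvgC)`, ★★`TJP_rows_at_regPr` — UNCONDITIONAL at `U₀ ∈ 𝔘_k(ε₀)` (`hAvgC` by
  ✓`avgHess_apply_smul_one_eq_zero_of_regPr`).
* §5 ★★`DeltaOnePJ_reality_rows_at_regPr` and ★★★ **`H1f_isHermitian_traceless_at_regPr_DeltaOnePJ`**, ★★★ **`frakGfR_isHermitian_traceless_at_regPr_DeltaOnePJ`** — the EX knit's
  `hH₁R`∕`h𝒢R` clauses AT `Δ₁` OF RECORD IN THE PINV LETTERS, unconditional at `RegPr` in the windows `10⁹L²e ≤ 1`, `10¹²L³ε₀ ≤ 1` for `0 ≤ a` (twins of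
  ✓`H1f_isHermitian_traceless_at_regPr_DeltaOneJ'` ∕ ✓`frakGfR_isHermitian_traceless_at_regPr_DeltaOneJ'`).
HONEST SCOPE.  Reality bookkeeping only; no estimate; `hPos₁`∕`hPosπ` (Thm 3.11) untouched; the stub stays open.

References: T. Bałaban, CMP 99 (1985) 389–434 [Balaban1985BackgroundPropagators] ((3.7) p.391, (3.11)–(3.14) pp.392–393, (3.119) p.419, (3.126)–(3.129) pp.420–421, p.393); CMP 102 (1985)
277–309 [Balaban1985Variational] ((51) p.286, (103) p.293, (110)–(111) p.294).
-/

set_option autoImplicit false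

noncomputable section

open scoped InnerProductSpace ComplexConjugate Matrix.Norms.L2Operator BigOperators

namespace Summit.QuantumFields.YangMills.Theorems.Prop7SectET3RealityPInvJTerm

open Literature.MathematicalPhysics.QuantumFieldTheory.Balaban1983to89
open Literature.MathematicalPhysics.QuantumFieldTheory.Balaban1983to89.T3ContinuumYM3Torus
open T3SectALandauChart (eta eta_pos)
open T3PrintedRegularMinimiser (RegPr)
open B9SectCLatticeCarrier (Bond)
open B9Eq311L2Pairing (WL2)
open B11Eq103H1Complex (SiteL2K BondL2K)
open B11Eq115Space (NegSup NegSize JetSup)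
open Summit.QuantumFields.YangMills.Theorems.Prop7SectET3Transport (periodsT3 siteEquiv bondEquiv bgOfCfg)
open Summit.QuantumFields.YangMills.Theorems.Prop7SectET3HilbertLetters (W₂ frobEquiv toL2 toL2S toL2B QL2 DL2 DstarL2 QL2_toL2 inner_toL2 inner_toL2B adjoint_DL2 toL2_symm_apply)
open Summit.QuantumFields.YangMills.Theorems.Prop7SectET3CurvedPropagators (frakGfR H1f Hf)
open Summit.QuantumFields.YangMills.Theorems.Prop7SectET3WilsonHessian (DeltaEta DeltaEta_isSymmetric DeltaEta_toL2_star toL2CLM inner_toL2_star_left)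
open Summit.QuantumFields.YangMills.Theorems.Prop7SectET3DeltaPiPInv (gaugeCorrP DeltaPiP DeltaPiSlotP H46P DeltaPiP_isSymmetric)
open Summit.QuantumFields.YangMills.Theorems.Prop7SectET3DeltaOnePInv (DeltaOneP H46LP tjFormP tjSesqP TJP TJSlotP DeltaOnePJ DeltaOneP_apply inner_DeltaOneP
  H46LP_apply tjFormP_apply tjSesqP_apply inner_TJP_left TJSlotP_apply DeltaOnePJ_def)
open Summit.QuantumFields.YangMills.Theorems.Prop7SectET3DeltaOne (actionGrad avgHess avgHess_def actionGrad_star avgHess_apply_smul_one_eq_zero_of_regPr)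
open Summit.QuantumFields.YangMills.Theorems.Prop7SymAvgTwSym (QTwS QTwS_star_comm_of_regPr QTwS_scalar_of_regPr QTwS_traceless_of_regPr)
open Summit.QuantumFields.YangMills.Theorems.Prop7SectET3PropagatorsReality (adjoint_comm_of_kind map_zero_of_map_add map_sub_of_map_add)
open Summit.QuantumFields.YangMills.Theorems.Prop7SectET3HilbertLettersReality (toL2_star_star toL2_star_add toL2_star_smul_real inner_toL2_star toL2S_star_star toL2S_star_add
  toL2S_star_smul_real inner_toL2S_star toL2B_star_star toL2B_star_add toL2B_star_smul_real inner_toL2B_star DL2_star_comm QL2_star_comm_of trace_DL2_apply_eq_zero)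
open Summit.QuantumFields.YangMills.Theorems.Prop7H46RealityTrace (reflection_comm_of_mapsTo mapsTo_orthogonal_of_adjoint exists_smul_one_of_trace_orthogonal trace_conjTranspose_mul_smul_one
  trace_DstarL2_apply_eq_zero)
open Summit.QuantumFields.YangMills.Theorems.Prop7H46Reality (Hf_star_comm)
open Summit.QuantumFields.YangMills.Theorems.Prop7WilsonHessianSectorRows (trace_DeltaEta_toL2_eq_zero)
open Summit.QuantumFields.YangMills.Theorems.Prop7FrakGReality (frakGfR_isHermitian_traceless_at_regPr)
open Summit.QuantumFields.YangMills.Theorems.Prop7HfRealityTrace (H1f_isHermitian_traceless_at_regPr)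
open Summit.QuantumFields.YangMills.Theorems.Prop7QTwSHessianReality (fderiv_fderiv_logChartTwS_symm_of_regPr fderiv_fderiv_logChartTwS_star_of_traceless)
open Summit.QuantumFields.YangMills.Theorems.Prop7SectET3RealityPInv (gaugeCorrP_comm DeltaPiSlotP_toL2_star_of_rows)
open Summit.QuantumFields.YangMills.Theorems.Prop7SectET3RealityPInvOne (DeltaOneP_comm DeltaOneP_isSymmetric DeltaOneP_toL2_star_of_regPr trace_DeltaOneP_toL2_eq_zero_of_regPr
  H1f_isHermitian_traceless_at_regPr_DeltaOneP frakGfR_isHermitian_traceless_at_regPr_DeltaOneP)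

variable (F : T3Family) (n K : ℕ) (h : n ≤ K) (c₀ cB a : ℝ) [Fact (0 < c₀)] [Fact (0 < cB)]
variable (TJ : GaugeField (F.P K) 0 (Matrix.specialUnitaryGroup (Fin 2) ℂ) → (BondL2K ℂ 3 (periodsT3 F K) c₀ W₂ →ₗ[ℂ] BondL2K ℂ 3 (periodsT3 F K) c₀ W₂))
variable (U₀ : GaugeField (F.P K) 0 (Matrix.specialUnitaryGroup (Fin 2) ℂ))

/-! ## §4 The J-term at the pinv letter: the form `t_Jᴾ` and the operator `T_Jᴾ` are symmetric and real when `C⁽²⁾` is -/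

section FormRows

variable {F n K h c₀ cB a}
variable (ha : 0 ≤ a)
  (hQ : ∀ A : PBond (F.P K) 0 → Matrix (Fin 2) (Fin 2) ℂ, QTwS F n K h U₀ (star A) = star (QTwS F n K h U₀ A))
  (hAs : ∀ X Y : PBond (F.P K) 0 → Matrix (Fin 2) (Fin 2) ℂ, avgHess F n K h U₀ X Y = avgHess F n K h U₀ Y X)
  (hAr : ∀ X Y : PBond (F.P K) 0 → Matrix (Fin 2) (Fin 2) ℂ, (∀ b, (X b).trace = 0) → (∀ b, (Y b).trace = 0) →
    ∀ c, avgHess F n K h U₀ (star X) (star Y) c = -star (avgHess F n K h U₀ X Y c))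
  (hAc : ∀ (X : PBond (F.P K) 0 → Matrix (Fin 2) (Fin 2) ℂ) (z : PBond (F.P K) 0 → ℂ), avgHess F n K h U₀ X (fun b => z b • (1 : Matrix (Fin 2) (Fin 2) ℂ)) = 0)

include ha hQ in
/-- ★★ **`H46P U₀` COMMUTES WITH `X ↦ Xᴴ`** (slot-generic ✓`Hf_star_comm` at `Δx := DeltaPiSlotP` with part 1's σ-row). [cite: Balaban1985Variational, (45)–(46) p.285, (51) p.286] -/
theorem H46P_star_comm (Y : PBond (F.P n) 0 → Matrix (Fin 2) (Fin 2) ℂ) : H46P F n K h c₀ cB a U₀ (star Y) = star (H46P F n K h c₀ cB a U₀ Y) :=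
  Hf_star_comm F n K h c₀ cB a (DeltaPiSlotP F n K h c₀ cB a) U₀ hQ (DeltaPiSlotP_toL2_star_of_rows F n K h c₀ cB a U₀ ha hQ) Y

include hAs in
/-- **`t_Jᴾ` IS SYMMETRIC WHEN `C⁽²⁾` IS.** [cite: Balaban1985BackgroundPropagators, (3.127) p.421] -/
theorem tjFormP_symm (X Y : PBond (F.P K) 0 → Matrix (Fin 2) (Fin 2) ℂ) : tjFormP F n K h c₀ cB a U₀ X Y = tjFormP F n K h c₀ cB a U₀ Y X := by
  rw [tjFormP_apply, tjFormP_apply, hAs]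

include hAc in
/-- **`t_Jᴾ` VANISHES ON CENTRAL DIRECTIONS IN THE SECOND SLOT WHEN `C⁽²⁾` DOES.** [cite: Balaban1985BackgroundPropagators, (3.127) p.421] -/
theorem tjFormP_apply_smul_one (X : PBond (F.P K) 0 → Matrix (Fin 2) (Fin 2) ℂ) (z : PBond (F.P K) 0 → ℂ) :
    tjFormP F n K h c₀ cB a U₀ X (fun b => z b • (1 : Matrix (Fin 2) (Fin 2) ℂ)) = 0 := by
  rw [tjFormP_apply, hAc, map_zero, map_zero, neg_zero]

include hAs hAc in
/-- … and in the first slot (symmetry). [cite: Balaban1985BackgroundPropagators, (3.127) p.421] -/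
theorem tjFormP_smul_one_apply (z : PBond (F.P K) 0 → ℂ) (X : PBond (F.P K) 0 → Matrix (Fin 2) (Fin 2) ℂ) :
    tjFormP F n K h c₀ cB a U₀ (fun b => z b • (1 : Matrix (Fin 2) (Fin 2) ℂ)) X = 0 := by
  rw [tjFormP_symm U₀ hAs]; exact tjFormP_apply_smul_one U₀ hAc X z

include ha hQ hAs hAr hAc in
/-- ★★ **`t_Jᴾ` IS REAL: `t_Jᴾ[Xᴴ, Yᴴ] = conj t_Jᴾ[X, Y]`** — the text of ✓`tjForm_star` with `H46P_star_comm` for `H46_star_comm`.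
[cite: Balaban1985BackgroundPropagators, (3.127) p.421; Balaban1985Variational, (51) p.286] -/
theorem tjFormP_star (X Y : PBond (F.P K) 0 → Matrix (Fin 2) (Fin 2) ℂ) :
    tjFormP F n K h c₀ cB a U₀ (star X) (star Y) = conj (tjFormP F n K h c₀ cB a U₀ X Y) := by
  set x : PBond (F.P K) 0 → ℂ := fun b => (2 : ℂ)⁻¹ * (X b).trace with hx_def
  set y : PBond (F.P K) 0 → ℂ := fun b => (2 : ℂ)⁻¹ * (Y b).trace with hy_def
  set X₀ : PBond (F.P K) 0 → Matrix (Fin 2) (Fin 2) ℂ := X - fun b => x b • (1 : Matrix (Fin 2) (Fin 2) ℂ) with hX₀_def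
  set Y₀ : PBond (F.P K) 0 → Matrix (Fin 2) (Fin 2) ℂ := Y - fun b => y b • (1 : Matrix (Fin 2) (Fin 2) ℂ) with hY₀_def
  have htr1 : Matrix.trace (1 : Matrix (Fin 2) (Fin 2) ℂ) = 2 := by rw [Matrix.trace_one, Fintype.card_fin]; norm_num
  have hX₀ : ∀ b, (X₀ b).trace = 0 := fun b => by rw [hX₀_def, Pi.sub_apply, Matrix.trace_sub, Matrix.trace_smul, htr1, smul_eq_mul, hx_def]; ring
  have hY₀ : ∀ b, (Y₀ b).trace = 0 := fun b => by rw [hY₀_def, Pi.sub_apply, Matrix.trace_sub, Matrix.trace_smul, htr1, smul_eq_mul, hy_def]; ring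
  have hXd : X = X₀ + fun b => x b • (1 : Matrix (Fin 2) (Fin 2) ℂ) := by rw [hX₀_def, sub_add_cancel]
  have hYd : Y = Y₀ + fun b => y b • (1 : Matrix (Fin 2) (Fin 2) ℂ) := by rw [hY₀_def, sub_add_cancel]
  have hstar_c : ∀ z : PBond (F.P K) 0 → ℂ, star (fun b => z b • (1 : Matrix (Fin 2) (Fin 2) ℂ)) = fun b => (starRingEnd ℂ (z b)) • (1 : Matrix (Fin 2) (Fin 2) ℂ) :=
    fun z => funext fun b => by rw [Pi.star_apply, star_smul, Matrix.star_eq_conjTranspose, Matrix.conjTranspose_one, Complex.star_def]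
  have hXs : star X = star X₀ + fun b => (starRingEnd ℂ (x b)) • (1 : Matrix (Fin 2) (Fin 2) ℂ) := by rw [hXd, star_add, hstar_c]
  have hYs : star Y = star Y₀ + fun b => (starRingEnd ℂ (y b)) • (1 : Matrix (Fin 2) (Fin 2) ℂ) := by rw [hYd, star_add, hstar_c]
  have red : tjFormP F n K h c₀ cB a U₀ X Y = tjFormP F n K h c₀ cB a U₀ X₀ Y₀ := by
    conv_lhs => rw [hXd, hYd]
    simp only [map_add, add_apply, tjFormP_apply_smul_one U₀ hAc, tjFormP_smul_one_apply U₀ hAs hAc, add_zero]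
  have reds : tjFormP F n K h c₀ cB a U₀ (star X) (star Y) = tjFormP F n K h c₀ cB a U₀ (star X₀) (star Y₀) := by
    rw [hXs, hYs]
    simp only [map_add, add_apply, tjFormP_apply_smul_one U₀ hAc, tjFormP_smul_one_apply U₀ hAs hAc, add_zero]
  have hM : avgHess F n K h U₀ (star X₀) (star Y₀) = -star (avgHess F n K h U₀ X₀ Y₀) := funext fun c => by rw [Pi.neg_apply, Pi.star_apply]; exact hAr X₀ Y₀ hX₀ hY₀ c
  rw [red, reds, tjFormP_apply, tjFormP_apply, hM, map_neg, map_neg, neg_neg, H46P_star_comm U₀ ha hQ, actionGrad_star, map_neg]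

include ha hQ hAs hAr hAc in
/-- ★★ **THE SESQUILINEAR FORM OF `T_Jᴾ` IS CONJUGATE-SYMMETRIC: `conj (tjSesqP U₀ w v) = tjSesqP U₀ v w`.** [cite: Balaban1985BackgroundPropagators, (3.127) p.421] -/
theorem tjSesqP_conj_symm (v w : BondL2K ℂ 3 (periodsT3 F K) c₀ W₂) :
    conj (tjSesqP F n K h c₀ cB a U₀ w v) = tjSesqP F n K h c₀ cB a U₀ v w := by
  have hc : conj ((-(2 * (c₀ : ℂ)) / (((eta F n K : ℝ) : ℂ)) ^ 2)) = (-(2 * (c₀ : ℂ)) / (((eta F n K : ℝ) : ℂ)) ^ 2) := by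
    rw [map_div₀, map_neg, map_mul, map_pow, map_ofNat, Complex.conj_ofReal, Complex.conj_ofReal]
  rw [tjSesqP_apply, tjSesqP_apply, map_mul, hc, ← tjFormP_star U₀ ha hQ hAs hAr hAc, star_star, tjFormP_symm U₀ hAs]

include ha hQ hAs hAr hAc in
/-- ★ **`T_Jᴾ(U₀)` COMMUTES WITH THE REAL STRUCTURE `σ = toL2 ∘ star ∘ toL2⁻¹`** (the row `hT`). [cite: Balaban1985BackgroundPropagators, (3.127) p.421; Balaban1985Variational, (51) p.286] -/
theorem TJP_toL2_star_of_rows :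
    ∀ f : BondL2K ℂ 3 (periodsT3 F K) c₀ W₂,
      TJP F n K h c₀ cB a U₀ (toL2 F K c₀ (star ((toL2 F K c₀).symm f))) = toL2 F K c₀ (star ((toL2 F K c₀).symm (TJP F n K h c₀ cB a U₀ f))) := by
  intro f
  have hc : conj ((-(2 * (c₀ : ℂ)) / (((eta F n K : ℝ) : ℂ)) ^ 2)) = (-(2 * (c₀ : ℂ)) / (((eta F n K : ℝ) : ℂ)) ^ 2) := by
    rw [map_div₀, map_neg, map_mul, map_pow, map_ofNat, Complex.conj_ofReal, Complex.conj_ofReal]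
  obtain ⟨X, rfl⟩ : ∃ X, toL2 F K c₀ X = f := ⟨(toL2 F K c₀).symm f, (toL2 F K c₀).apply_symm_apply f⟩
  rw [LinearEquiv.symm_apply_apply]
  refine ext_inner_right ℂ fun w => ?_
  obtain ⟨Y, rfl⟩ : ∃ Y, toL2 F K c₀ Y = w := ⟨(toL2 F K c₀).symm w, (toL2 F K c₀).apply_symm_apply w⟩
  rw [inner_TJP_left, tjSesqP_apply, LinearEquiv.symm_apply_apply, LinearEquiv.symm_apply_apply, star_star, inner_toL2_star_left, LinearEquiv.apply_symm_apply,
    inner_TJP_left, tjSesqP_apply, LinearEquiv.symm_apply_apply, LinearEquiv.symm_apply_apply, map_mul, hc, ← tjFormP_star U₀ ha hQ hAs hAr hAc, star_star, star_star]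

open Classical in
include hAc in
/-- ★ **`T_Jᴾ(U₀)` MAPS EVERY FIELD TO A TRACELESS FIELD** (the row `hTtr`): pair with `δ_b·1`; `t_Jᴾ` is flat on the centre. [cite: Balaban1985BackgroundPropagators, (3.127) p.421; Balaban1985Variational, (51) p.286] -/
theorem trace_TJP_toL2_eq_zero_of_rows (A : PBond (F.P K) 0 → Matrix (Fin 2) (Fin 2) ℂ) (b : PBond (F.P K) 0) :
    ((toL2 F K c₀).symm (TJP F n K h c₀ cB a U₀ (toL2 F K c₀ A)) b).trace = 0 := by
  set Z : PBond (F.P K) 0 → Matrix (Fin 2) (Fin 2) ℂ := (toL2 F K c₀).symm (TJP F n K h c₀ cB a U₀ (toL2 F K c₀ A)) with hZ_def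
  have hE : (Pi.single b (1 : Matrix (Fin 2) (Fin 2) ℂ) : PBond (F.P K) 0 → Matrix (Fin 2) (Fin 2) ℂ) =
      fun b' => (Pi.single b (1 : ℂ) : PBond (F.P K) 0 → ℂ) b' • (1 : Matrix (Fin 2) (Fin 2) ℂ) := by
    funext b'
    by_cases hb : b' = b
    · subst hb; rw [Pi.single_eq_same, Pi.single_eq_same, one_smul]
    · rw [Pi.single_eq_of_ne hb, Pi.single_eq_of_ne hb, zero_smul]
  have key : ⟪TJP F n K h c₀ cB a U₀ (toL2 F K c₀ A), toL2 F K c₀ (Pi.single b (1 : Matrix (Fin 2) (Fin 2) ℂ))⟫_ℂ = 0 := by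
    rw [inner_TJP_left, tjSesqP_apply, LinearEquiv.symm_apply_apply, LinearEquiv.symm_apply_apply, hE, tjFormP_apply_smul_one U₀ hAc, mul_zero]
  have h2 : ⟪toL2 F K c₀ (Pi.single b (1 : Matrix (Fin 2) (Fin 2) ℂ)), toL2 F K c₀ Z⟫_ℂ = (c₀ : ℂ) * (Z b).trace := by
    rw [inner_toL2, Finset.sum_eq_single b (fun b' _ hb' => by rw [Pi.single_eq_of_ne hb', Matrix.conjTranspose_zero, Matrix.zero_mul, Matrix.trace_zero])
      (fun hb => (hb (Finset.mem_univ b)).elim), Pi.single_eq_same, Matrix.conjTranspose_one, Matrix.one_mul]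
  have h3 : ⟪toL2 F K c₀ (Pi.single b (1 : Matrix (Fin 2) (Fin 2) ℂ)), toL2 F K c₀ Z⟫_ℂ = 0 := by
    rw [hZ_def, LinearEquiv.apply_symm_apply, ← inner_conj_symm, key, map_zero]
  have hc₀ : (c₀ : ℂ) ≠ 0 := Complex.ofReal_ne_zero.2 (Fact.out : 0 < c₀).ne'
  rw [h3] at h2
  exact (mul_eq_zero.1 h2.symm).resolve_left hc₀

end FormRows

/-- ★★ **THE THREE ROWS OF `T_Jᴾ(U₀)` AT `U₀ ∈ 𝔘_k(ε₀)` MODULO THE CENTRE ROW `hAvgC`** (windows `10⁹L²e ≤ 1`, `10¹²L³ε₀ ≤ 1`; `0 ≤ a`): σ-row, traceless row, symmetry — the text of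
✓`TJ_rows_of_regPr` at the pinv letter. [cite: Balaban1985BackgroundPropagators, (3.127)–(3.128) p.421, (3.14) p.393; Balaban1985Variational, (51) p.286] -/
theorem TJP_rows_of_regPr [Fact (0 < (F.L : ℝ))] [Fact (0 < ((F.L : ℝ)⁻¹) ^ (K - n))] (ha : 0 ≤ a)
    {ε₀ e : ℝ} (hε₀ : 0 < ε₀) (he : 0 < e) (hWe : 10 ^ 9 * (F.L : ℝ) ^ 2 * e ≤ 1) (hWε : 10 ^ 12 * (F.L : ℝ) ^ 3 * ε₀ ≤ 1) (hreg : RegPr F n K ε₀ U₀)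
    (hAvgC : ∀ (X : PBond (F.P K) 0 → Matrix (Fin 2) (Fin 2) ℂ) (z : PBond (F.P K) 0 → ℂ), avgHess F n K h U₀ X (fun b => z b • (1 : Matrix (Fin 2) (Fin 2) ℂ)) = 0) :
    (∀ f : BondL2K ℂ 3 (periodsT3 F K) c₀ W₂,
        TJP F n K h c₀ cB a U₀ (toL2 F K c₀ (star ((toL2 F K c₀).symm f))) = toL2 F K c₀ (star ((toL2 F K c₀).symm (TJP F n K h c₀ cB a U₀ f)))) ∧
      (∀ A : PBond (F.P K) 0 → Matrix (Fin 2) (Fin 2) ℂ, (∀ b, (A b).trace = 0) → ∀ b, ((toL2 F K c₀).symm (TJP F n K h c₀ cB a U₀ (toL2 F K c₀ A)) b).trace = 0) ∧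
      ((TJP F n K h c₀ cB a U₀ : BondL2K ℂ 3 (periodsT3 F K) c₀ W₂ →L[ℂ] BondL2K ℂ 3 (periodsT3 F K) c₀ W₂) :
        BondL2K ℂ 3 (periodsT3 F K) c₀ W₂ →ₗ[ℂ] BondL2K ℂ 3 (periodsT3 F K) c₀ W₂).IsSymmetric := by
  have hQ := QTwS_star_comm_of_regPr F h hε₀ he hWe hWε U₀ hreg
  have hAs : ∀ X Y : PBond (F.P K) 0 → Matrix (Fin 2) (Fin 2) ℂ, avgHess F n K h U₀ X Y = avgHess F n K h U₀ Y X := fun X Y => by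
    rw [avgHess_def]; exact fderiv_fderiv_logChartTwS_symm_of_regPr F h hε₀ he hWe hWε U₀ hreg X Y
  have hAr : ∀ X Y : PBond (F.P K) 0 → Matrix (Fin 2) (Fin 2) ℂ, (∀ b, (X b).trace = 0) → (∀ b, (Y b).trace = 0) →
      ∀ c, avgHess F n K h U₀ (star X) (star Y) c = -star (avgHess F n K h U₀ X Y c) := fun X Y hX hY c => by
    rw [avgHess_def]; exact fderiv_fderiv_logChartTwS_star_of_traceless F h hε₀ he hWe hWε U₀ hreg X Y hX hY c
  -- symmetry of `T_Jᴾ` (the text of ✓`TJ_isSymmetric_of_rows`, inlined — the standalone twin would restate it)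
  have hsymm : ((TJP F n K h c₀ cB a U₀ : BondL2K ℂ 3 (periodsT3 F K) c₀ W₂ →L[ℂ] BondL2K ℂ 3 (periodsT3 F K) c₀ W₂) :
      BondL2K ℂ 3 (periodsT3 F K) c₀ W₂ →ₗ[ℂ] BondL2K ℂ 3 (periodsT3 F K) c₀ W₂).IsSymmetric := by
    intro v w
    show ⟪TJP F n K h c₀ cB a U₀ v, w⟫_ℂ = ⟪v, TJP F n K h c₀ cB a U₀ w⟫_ℂ
    rw [inner_TJP_left, ← inner_conj_symm, inner_TJP_left, tjSesqP_conj_symm U₀ ha hQ hAs hAr hAvgC]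
  exact ⟨TJP_toL2_star_of_rows U₀ ha hQ hAs hAr hAvgC, fun A _ b => trace_TJP_toL2_eq_zero_of_rows U₀ hAvgC A b, hsymm⟩

/-- ★★ **THE THREE ROWS OF `T_Jᴾ(U₀)`, UNCONDITIONAL AT `U₀ ∈ 𝔘_k(ε₀)`** (`hAvgC` by ✓`avgHess_apply_smul_one_eq_zero_of_regPr`; `0 ≤ a`).
[cite: Balaban1985BackgroundPropagators, (3.127)–(3.128) p.421; Balaban1985Variational, (51) p.286] -/
theorem TJP_rows_at_regPr [Fact (0 < (F.L : ℝ))] [Fact (0 < ((F.L : ℝ)⁻¹) ^ (K - n))] (ha : 0 ≤ a)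
    {ε₀ e : ℝ} (hε₀ : 0 < ε₀) (he : 0 < e) (hWe : 10 ^ 9 * (F.L : ℝ) ^ 2 * e ≤ 1) (hWε : 10 ^ 12 * (F.L : ℝ) ^ 3 * ε₀ ≤ 1) (hreg : RegPr F n K ε₀ U₀) :
    (∀ f : BondL2K ℂ 3 (periodsT3 F K) c₀ W₂,
        TJP F n K h c₀ cB a U₀ (toL2 F K c₀ (star ((toL2 F K c₀).symm f))) = toL2 F K c₀ (star ((toL2 F K c₀).symm (TJP F n K h c₀ cB a U₀ f)))) ∧
      (∀ A : PBond (F.P K) 0 → Matrix (Fin 2) (Fin 2) ℂ, (∀ b, (A b).trace = 0) → ∀ b, ((toL2 F K c₀).symm (TJP F n K h c₀ cB a U₀ (toL2 F K c₀ A)) b).trace = 0) ∧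
      ((TJP F n K h c₀ cB a U₀ : BondL2K ℂ 3 (periodsT3 F K) c₀ W₂ →L[ℂ] BondL2K ℂ 3 (periodsT3 F K) c₀ W₂) :
        BondL2K ℂ 3 (periodsT3 F K) c₀ W₂ →ₗ[ℂ] BondL2K ℂ 3 (periodsT3 F K) c₀ W₂).IsSymmetric :=
  TJP_rows_of_regPr F n K h c₀ cB a U₀ ha hε₀ he hWe hWε hreg (avgHess_apply_smul_one_eq_zero_of_regPr F h hε₀ hWε U₀ hreg)

/-! ## §5 ★★★ At `Δ₁` of record in the pinv letters (`DeltaOnePJ := DeltaOneP TJSlotP`) — unconditional -/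

/-- ★★ **THE `Δ₁`-OF-RECORD SLOT ROWS AT THE PINV LETTERS, UNCONDITIONAL AT `U₀ ∈ 𝔘_k(ε₀)`** (`0 ≤ a`) — the `hΔx`∕`hΔtr`∕`hΔsymm` binder shapes of the generic reality theorems at
`Δx := DeltaOnePJ …` (twin of ✓`DeltaOneJ_reality_rows_at_regPr`). [cite: Balaban1985BackgroundPropagators, (3.128) p.421; Balaban1985Variational, (51) p.286] -/
theorem DeltaOnePJ_reality_rows_at_regPr [Fact (0 < (F.L : ℝ))] [Fact (0 < ((F.L : ℝ)⁻¹) ^ (K - n))] (ha : 0 ≤ a)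
    {ε₀ e : ℝ} (hε₀ : 0 < ε₀) (he : 0 < e) (hWe : 10 ^ 9 * (F.L : ℝ) ^ 2 * e ≤ 1) (hWε : 10 ^ 12 * (F.L : ℝ) ^ 3 * ε₀ ≤ 1) (hreg : RegPr F n K ε₀ U₀) :
    (∀ f : BondL2K ℂ 3 (periodsT3 F K) c₀ W₂,
        DeltaOnePJ F n K h c₀ cB a U₀ (toL2 F K c₀ (star ((toL2 F K c₀).symm f))) = toL2 F K c₀ (star ((toL2 F K c₀).symm (DeltaOnePJ F n K h c₀ cB a U₀ f)))) ∧
      (∀ A : PBond (F.P K) 0 → Matrix (Fin 2) (Fin 2) ℂ, (∀ b, (A b).trace = 0) →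
        ∀ b, ((toL2 F K c₀).symm (DeltaOnePJ F n K h c₀ cB a U₀ (toL2 F K c₀ A)) b).trace = 0) ∧
      (DeltaOnePJ F n K h c₀ cB a U₀).IsSymmetric := by
  obtain ⟨hT, hTtr, hTsymm⟩ := TJP_rows_at_regPr F n K h c₀ cB a U₀ ha hε₀ he hWe hWε hreg
  rw [DeltaOnePJ_def]
  exact ⟨DeltaOneP_toL2_star_of_regPr F n K h c₀ cB a (TJSlotP F n K h c₀ cB a) U₀ ha hε₀ he hWe hWε hreg hT,
    trace_DeltaOneP_toL2_eq_zero_of_regPr F n K h c₀ cB a (TJSlotP F n K h c₀ cB a) U₀ ha hε₀ he hWe hWε hreg hTtr hTsymm,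
    DeltaOneP_isSymmetric F n K h c₀ cB a (TJSlotP F n K h c₀ cB a) U₀ hTsymm⟩

/-- ★★★ **THE KNIT'S `hH₁R` CLAUSE AT `Δ₁` OF RECORD IN THE PINV LETTERS — UNCONDITIONAL AT `U₀ ∈ 𝔘_k(ε₀)`** in the windows `10⁹L²e ≤ 1`, `10¹²L³ε₀ ≤ 1`, for `0 ≤ a`:
Hermitian traceless block data `B` give Hermitian traceless `(H₁f … (DeltaOnePJ …) U₀ B)(x)` (twin of ✓`H1f_isHermitian_traceless_at_regPr_DeltaOneJ'`).
[cite: Balaban1985Variational, (103) p.293, (110) p.294, (51) p.286; Balaban1985BackgroundPropagators, (3.127)–(3.129) p.421] -/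
theorem H1f_isHermitian_traceless_at_regPr_DeltaOnePJ [Fact (0 < (F.L : ℝ))] [Fact (0 < ((F.L : ℝ)⁻¹) ^ (K - n))] (ha : 0 ≤ a)
    {ε₀ e : ℝ} (hε₀ : 0 < ε₀) (he : 0 < e) (hWe : 10 ^ 9 * (F.L : ℝ) ^ 2 * e ≤ 1) (hWε : 10 ^ 12 * (F.L : ℝ) ^ 3 * ε₀ ≤ 1) (hreg : RegPr F n K ε₀ U₀) :
    ∀ B : PBond (F.P n) 0 → Matrix (Fin 2) (Fin 2) ℂ, (∀ c, (B c).IsHermitian ∧ (B c).trace = 0) →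
      ∀ x : Bond 3 (periodsT3 F K), (JetSup.equiv _ _ _ (H1f F n K h c₀ cB a (DeltaOnePJ F n K h c₀ cB a) U₀ B) x).IsHermitian ∧
        (JetSup.equiv _ _ _ (H1f F n K h c₀ cB a (DeltaOnePJ F n K h c₀ cB a) U₀ B) x).trace = 0 := by
  obtain ⟨hT, hTtr, hTsymm⟩ := TJP_rows_at_regPr F n K h c₀ cB a U₀ ha hε₀ he hWe hWε hreg
  rw [DeltaOnePJ_def]
  exact H1f_isHermitian_traceless_at_regPr_DeltaOneP F n K h c₀ cB a (TJSlotP F n K h c₀ cB a) U₀ ha hε₀ he hWe hWε hreg hT hTtr hTsymm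

/-- ★★★ **THE KNIT'S `h𝒢R` CLAUSE AT `Δ₁` OF RECORD IN THE PINV LETTERS — UNCONDITIONAL AT `U₀ ∈ 𝔘_k(ε₀)`** in the windows, for `0 ≤ a`: Hermitian traceless (−3)-data `f`
give Hermitian traceless (115)-fields `frakGfR … (DeltaOnePJ …) U₀ f` (twin of ✓`frakGfR_isHermitian_traceless_at_regPr_DeltaOneJ'`).
[cite: Balaban1985Variational, (110)–(111) p.294, (51) p.286; Balaban1985BackgroundPropagators, (3.128) p.421, (3.153) p.426] -/
theorem frakGfR_isHermitian_traceless_at_regPr_DeltaOnePJ [Fact (0 < (F.L : ℝ))] [Fact (0 < ((F.L : ℝ)⁻¹) ^ (K - n))] (ha : 0 ≤ a)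
    {ε₀ e : ℝ} (hε₀ : 0 < ε₀) (he : 0 < e) (hWe : 10 ^ 9 * (F.L : ℝ) ^ 2 * e ≤ 1) (hWε : 10 ^ 12 * (F.L : ℝ) ^ 3 * ε₀ ≤ 1) (hreg : RegPr F n K ε₀ U₀) :
    ∀ f : NegSize (F.L : ℝ) (((F.L : ℝ)⁻¹) ^ (K - n)) (fun _ : Bond 3 (periodsT3 F K) => K - n) 3 (Matrix (Fin 2) (Fin 2) ℂ),
      (∀ b, (NegSup.equiv _ _ f b).IsHermitian ∧ (NegSup.equiv _ _ f b).trace = 0) →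
      ∀ b, (JetSup.equiv _ _ _ (frakGfR F n K h c₀ cB a (DeltaOnePJ F n K h c₀ cB a) U₀ f) b).IsHermitian ∧
        (JetSup.equiv _ _ _ (frakGfR F n K h c₀ cB a (DeltaOnePJ F n K h c₀ cB a) U₀ f) b).trace = 0 := by
  obtain ⟨hT, hTtr, hTsymm⟩ := TJP_rows_at_regPr F n K h c₀ cB a U₀ ha hε₀ he hWe hWε hreg
  rw [DeltaOnePJ_def]
  exact frakGfR_isHermitian_traceless_at_regPr_DeltaOneP F n K h c₀ cB a (TJSlotP F n K h c₀ cB a) U₀ ha hε₀ he hWe hWε hreg hT hTtr hTsymm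

end Summit.QuantumFields.YangMills.Theorems.Prop7SectET3RealityPInvJTerm

end
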